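import Mathlib
import Summits.Ventures.HodgeRepro0.P1LatticeIndexTwoExactCore1

/-!
# P1LatticeIndexTwoExactCore2 — D13's THEOREM A (proofs/P1-FermatLatticeClosure-v1.2.md l.4, DECLARED STATUS l.4789) at its
INDEX-2 degrees: the «EXACTLY 2» half of the clause «[H_M : L_M] = 2 and 2H_M ⊂ L_M», kernel-checked — THE CORE, PART 2 of 3: the arithmetic lemmas — the profiles' semantics (`prof3_some`, `prof2_some`), the modular bookkeeping, sorted representatives, complementary profiles (`prof_add_compl`), the complementary keys, the cancelling pairs
(pub-hodge-repro0, p1 (g28), 2026-08-30) — the companion of lean/P1LatticeIndexTwoA–F.lean (p1 (g27), STATUS l.11237: the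
containment half 2·H_M ⊆ L_M).

Supporting artefact in the sense of ROUTE.md R-5 (finite combinatorics / exact arithmetic only; never the discharge of a
Hodge-theoretic step; record-only).  THE OBJECTS, as the D13 page defines them (§1 l.7): odd vectors s ∈ ℤ^{⌊(M−1)/2⌋}
(the coordinate a ↔ the pair {a, M − a}, 1 ≤ a ≤ ⌊(M−1)/2⌋; for M even the coordinate M/2 is taken modulo the pair
(M/2, M/2) = 2e_{M/2} ∈ L_M and is NOT a coordinate here); H_M := the integer kernel of the weight constraints
Σₐ sₐ·(2·(t·a mod M) − M) = 0, t a unit mod M; L_M := the ℤ-span of the odd vectors of the LEGITIMATE BLOCKS — here stated as a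
PREDICATE on multisets (`IsBlock`), not a listed set: every Hodge 4-multiset of ℤ/M, every Hodge 6-multiset of ℤ/M that is the
sum of two zero-sum triples, every σ_{p,i} of Aoki's full p-standard set of level M (p an odd prime dividing M, 1 ≤ i < M,
(M/p)/gcd(i, M/p) > 2 — the level-M σ's with gcd(i, M/p) = 1 and the pull-backs of those of every level m′ ∣ M); the pull-backs
and unit translates of the 4- and 6-multisets of the levels m′ ∣ M are such multisets of level M themselves, so this set
contains every block of the page's Lemma 1 (b).  Per degree M the kernel certifies (`decide +kernel`; every number from the
generator's JSON, nothing typed by hand):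
* `units_eq_M` — the listed units are `unitsL M` (the t < M with gcd(t, M) = 1);
* `checkP_M`, `check6_M`, `checkS_M` — a ℤ/2-functional χ_M (`chi_M`, on the coordinates a < M/2) has EVEN value on the odd
  vector of EVERY block: every Hodge 4-multiset through its two sorted pairs — for every sorted pair [a, b] ⊂ [1, M−1] with
  a + b ≢ 0 (mod M) the weights S(u, [a, b]) are ≢ 0 (mod M) and the table `tabP_M`, keyed by M·profile + ((a + b) mod M)
  (the profile = the bits [M < S(u, T)] over the units u < M/2), gives its parity at the key or at the complementary key
  (one of each complementary pair is stored), and the table's parities agree at complementary keys ([a, b] ∗ [c, d] with a + b ≢ 0 is Hodge iff c + d ≡ −(a + b) and the profiles are complementary, Lemma `par4`; the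
  cancelling case a + b ≡ 0 has odd vector 0, Lemma `oddVec_cancel`); every split Hodge 6-multiset through its zero-sum
  triples — for every sorted zero-sum triple T the weights lie in {M, 2M} and the table `tab6_M` keyed by the profile gives
  its parity (at the profile or its complement), the parities agreeing at complementary profiles (T₁ ∗ T₂ is Hodge iff the profiles are complementary, Lemma
  `par6`); every σ_{p,i} by enumeration;
* `witness_hodge_M`, `witness_in_H_M`, `witness_par_M` — an explicit Hodge multiset x_M (`xM_M`) with s(x_M) ∈ H_M and
  χ_M(s(x_M)) ODD — hence `witness_notin_M`: s(x_M) ∉ L_M (the span of the odd vectors of ALL blocks; the functional argument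
  `notin_of_parity`), so [H_M : L_M] ≥ 2 — the «≥» half of Theorem A's «= 2»;
* `blocks_ok_M`, `K_eq_M`, `cert_M`, `ker_sub_M` — every s ∈ H_M with χ_M(s) even is an integer combination of the odd vectors
  of listed legitimate level-M blocks (`blocks_M`, each checked a block): a certificate of the shape d·(1 − K̃ᵀ·W̃) = X̃·B̃ on the
  augmented system B̃ = [[BH_M, 0], [χ_M, −2]] (K̃ a ℤ-basis of its kernel, K̃ projected = C₀·G);
* `index_two_M` — hence H_M ⊓ L_M = H_M ⊓ {s : χ_M(s) even} while s(x_M) ∈ H_M has χ_M odd (`witness_not_le_M`): H_M ⊓ L_M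
  is EXACTLY the index-2 sublattice of H_M cut out by χ_M.  With L_M ⊆ H_M (every block is a Hodge multiset — the page's
  Lemma 1 (b)/(d), not formalised here) this is [H_M : L_M] = 2 on the coordinates a < M/2, i.e. Theorem A's index-2 claim at M
  once the coordinate M/2 is taken modulo 2e_{M/2} (the page's l.7 bookkeeping, as in the index-1 and index-2 artefacts).
NOT formalised: L_M ⊆ H_M; claim(·) for the blocks (Shioda 1981 Thm 4.3 / Lefschetz (1,1), Aoki 1987 Thm 2-1 / Thm 1-4);
anything Hodge-theoretic.  The data were found by gen_i2x.py (own enumeration of every block of the level, the mod-2 row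
space of their odd vectors, a sparse χ in its annihilator with χ(x_M) odd, the profile table, and the certificate by a greedy
tracked echelon over the level-M blocks; K̃ = the deposit routine intlin_local.int_kernel's basis).
Nothing here asserts anything about whether the statement of README §1 has been proved elsewhere.
-/

namespace HodgeRepro0.P1.P1LatticeIndexTwoExact
open Matrix

/-- a triple profile computed ⇒ every weight in {M, 2M} and the profile is the bit fold -/
theorem prof3_some (M : ℕ) (U : List ℕ) (T : List ℕ) (P : ℕ) (h : prof3 M U T = some P) :
    (∀ u ∈ U, S M u T = M ∨ S M u T = 2 * M) ∧ prof M U T = P := by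
  induction U generalizing P with
  | nil =>
    simp only [prof3, Option.some.injEq] at h
    exact ⟨by simp, by simp [prof, h]⟩
  | cons u U ih =>
    simp only [prof3] at h
    rcases hr : prof3 M U T with _ | q
    · rw [hr] at h
      simp at h
    · rw [hr] at h
      obtain ⟨hS, hP⟩ := ih q hr
      simp only at h
      by_cases h1 : S M u T = M
      · rw [if_pos h1] at h
        simp only [Option.some.injEq] at h
        refine ⟨fun v hv => ?_, ?_⟩
        · rcases List.mem_cons.mp hv with rfl | hv
          · exact Or.inl h1
          · exact hS v hv
        · simp only [prof, hP, h1, lt_irrefl, if_false]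
          omega
      · rw [if_neg h1] at h
        by_cases h2 : S M u T = 2 * M
        · rw [if_pos h2] at h
          simp only [Option.some.injEq] at h
          refine ⟨fun v hv => ?_, ?_⟩
          · rcases List.mem_cons.mp hv with rfl | hv
            · exact Or.inr h2
            · exact hS v hv
          · have hM : 0 < M := by
              by_contra h0
              have : M = 0 := by omega
              rw [this] at h1 h2
              exact h1 (by omega)
            have hlt : M < S M u T := by omega
            simp only [prof, hP, hlt, if_true]
            omega
        · rw [if_neg h2] at h
          simp at h

/-- a pair profile computed ⇒ every weight ≢ 0 (mod M) and the profile is the bit fold -/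
theorem prof2_some (M : ℕ) (U : List ℕ) (T : List ℕ) (P : ℕ) (h : prof2 M U T = some P) :
    (∀ u ∈ U, S M u T % M ≠ 0) ∧ prof M U T = P := by
  induction U generalizing P with
  | nil =>
    simp only [prof2, Option.some.injEq] at h
    exact ⟨by simp, by simp [prof, h]⟩
  | cons u U ih =>
    simp only [prof2] at h
    rcases hr : prof2 M U T with _ | q
    · rw [hr] at h
      simp at h
    · rw [hr] at h
      obtain ⟨hS, hP⟩ := ih q hr
      simp only at h
      by_cases h1 : S M u T % M = 0
      · rw [if_pos h1] at h
        simp at h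
      · rw [if_neg h1] at h
        simp only [Option.some.injEq] at h
        refine ⟨fun v hv => ?_, ?_⟩
        · rcases List.mem_cons.mp hv with rfl | hv
          · exact h1
          · exact hS v hv
        · simp only [prof, hP]
          omega

/-- the last entry of a zero-sum list is determined by the others -/
theorem mod_last (M x d : ℕ) (hd0 : 0 < d) (hdM : d < M) (h : (x + d) % M = 0) : (M - x % M) % M = d := by
  have hM : 0 < M := by omega
  have hr : x % M < M := Nat.mod_lt x hM
  have h1 : (x % M + d) % M = 0 := by
    rw [Nat.add_mod, Nat.mod_eq_of_lt hdM] at h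
    exact h
  by_cases hle : M ≤ x % M + d
  · rw [Nat.mod_eq_sub_mod hle, Nat.mod_eq_of_lt (by omega)] at h1
    have : M - x % M = d := by omega
    rw [this]
    exact Nat.mod_eq_of_lt hdM
  · rw [Nat.mod_eq_of_lt (by omega)] at h1
    omega

/-- a multiset of cardinality 3 is a sorted triple -/
theorem sorted3 (m : Multiset ℕ) (hc : Multiset.card m = 3) :
    ∃ a b c : ℕ, a ≤ b ∧ b ≤ c ∧ m = (([a, b, c] : List ℕ) : Multiset ℕ) := by
  have hl : (m.sort (· ≤ ·)).length = 3 := by rw [Multiset.length_sort, hc]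
  obtain ⟨a, b, c, h⟩ := List.length_eq_three.mp hl
  have hs := Multiset.pairwise_sort m (· ≤ ·)
  have he := Multiset.sort_eq m (· ≤ ·)
  rw [h] at hs he
  refine ⟨a, b, c, List.rel_of_pairwise_cons hs (by simp), List.rel_of_pairwise_cons hs.of_cons (by simp), he.symm⟩

/-- a multiset of cardinality 4 is a sorted quadruple -/
theorem sorted4 (m : Multiset ℕ) (hc : Multiset.card m = 4) :
    ∃ a b c d : ℕ, a ≤ b ∧ b ≤ c ∧ c ≤ d ∧ m = (([a, b, c, d] : List ℕ) : Multiset ℕ) := by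
  have hl : (m.sort (· ≤ ·)).length = 4 := by rw [Multiset.length_sort, hc]
  obtain ⟨a, b, c, d, h⟩ := List.length_eq_four.mp hl
  have hs := Multiset.pairwise_sort m (· ≤ ·)
  have he := Multiset.sort_eq m (· ≤ ·)
  rw [h] at hs he
  refine ⟨a, b, c, d, List.rel_of_pairwise_cons hs (by simp), List.rel_of_pairwise_cons hs.of_cons (by simp),
    List.rel_of_pairwise_cons hs.of_cons.of_cons (by simp), he.symm⟩

/-- complementary bits give complementary profiles: prof T₁ + prof T₂ = 2^|U| − 1 -/
theorem prof_add_compl (M : ℕ) (U T₁ T₂ : List ℕ)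
    (hb : ∀ u ∈ U, (if M < S M u T₁ then 1 else 0) + (if M < S M u T₂ then 1 else 0) = 1) :
    prof M U T₁ + prof M U T₂ = 2 ^ U.length - 1 := by
  induction U with
  | nil => simp [prof]
  | cons u U ih =>
    simp only [prof, List.length_cons, pow_succ]
    have h := hb u (by simp)
    have ih' := ih (fun v hv => hb v (List.mem_cons_of_mem _ hv))
    have hp : 0 < 2 ^ U.length := by positivity
    omega

/-- complementary weights (the triples: S ∈ {M, 2M}, S₁ + S₂ = 3M) give complementary profiles -/
theorem prof_compl3 (M : ℕ) (hM : 0 < M) (U T₁ T₂ : List ℕ)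
    (hu : ∀ u ∈ U, (S M u T₁ = M ∨ S M u T₁ = 2 * M) ∧ S M u T₁ + S M u T₂ = 3 * M) :
    prof M U T₁ + prof M U T₂ = 2 ^ U.length - 1 := by
  apply prof_add_compl
  intro u hu'
  obtain ⟨h1, h2⟩ := hu u hu'
  rcases h1 with h1 | h1
  · have h4 : ¬ M < S M u T₁ := by omega
    have h5 : M < S M u T₂ := by omega
    simp [h4, h5]
  · have h4 : M < S M u T₁ := by omega
    have h5 : ¬ M < S M u T₂ := by omega
    simp [h4, h5]

/-- complementary weights (the pairs: S ≢ 0 mod M, S₁ + S₂ = 2M) give complementary profiles -/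
theorem prof_compl2 (M : ℕ) (U T₁ T₂ : List ℕ)
    (hu : ∀ u ∈ U, S M u T₁ % M ≠ 0 ∧ S M u T₁ + S M u T₂ = 2 * M) :
    prof M U T₁ + prof M U T₂ = 2 ^ U.length - 1 := by
  apply prof_add_compl
  intro u hu'
  obtain ⟨h1, h2⟩ := hu u hu'
  have hne : S M u T₁ ≠ M := by
    intro h
    rw [h, Nat.mod_self] at h1
    exact h1 rfl
  by_cases h4 : M < S M u T₁
  · have h5 : ¬ M < S M u T₂ := by omega
    simp [h4, h5]
  · have h5 : M < S M u T₂ := by omega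
    simp [h4, h5]

/-- the complementary key of M·e₁ + σ₁ is M·e₂ + σ₂ when e₁ + e₂ = 2^|U| − 1 and σ₁ + σ₂ = M -/
theorem cokeyP_eq (M : ℕ) (hM : 0 < M) (U : List ℕ) (e₁ e₂ σ₁ σ₂ : ℕ) (h1 : e₁ + e₂ = 2 ^ U.length - 1)
    (hs1 : σ₁ < M) (hs : σ₁ + σ₂ = M) : cokeyP M U (M * e₁ + σ₁) = M * e₂ + σ₂ := by
  unfold cokeyP
  rw [Nat.mul_add_div hM, Nat.mul_add_mod, Nat.div_eq_of_lt hs1, Nat.mod_eq_of_lt hs1, Nat.add_zero]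
  have hp : 0 < 2 ^ U.length := by positivity
  have he : 2 ^ U.length - 1 - e₁ = e₂ := by omega
  rw [he]
  congr 1
  omega

/-- a sum that is ≡ 0 (mod M) and lies in (0, 2M) is M -/
theorem sum_eq_of_mod (M x : ℕ) (h0 : 0 < x) (h2 : x < 2 * M) (h : x % M = 0) : x = M := by
  by_cases hle : M ≤ x
  · rw [Nat.mod_eq_sub_mod hle, Nat.mod_eq_of_lt (by omega)] at h
    omega
  · rw [Nat.mod_eq_of_lt (by omega)] at h
    omega

/-- the odd vector of a union of two cancelling pairs is 0 -/
theorem oddVec_cancel {n : ℕ} (M a c : ℕ) (ha : 0 < a ∧ a < M) (hc : 0 < c ∧ c < M) (hn : n ≤ (M - 1) / 2) :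
    oddVec (n := n) M (([a, M - a, c, M - c] : List ℕ) : Multiset ℕ) = 0 := by
  funext x
  have hx : x.val < (M - 1) / 2 := Nat.lt_of_lt_of_le x.isLt hn
  simp only [oddVec, Multiset.coe_count, List.count_cons, List.count_nil, beq_iff_eq, Pi.zero_apply]
  push_cast
  split_ifs <;> omega

end HodgeRepro0.P1.P1LatticeIndexTwoExact
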